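import Literature.NumberTheory.Automorphic.GaussCellGL              -- ★ `IsBlockUpperUnipotent` ∕ `IsBlockLowerUnipotent` ∕ `IsBlockDiagonalFor`, `.transpose`, `.inv`, ★ `gauss_unique` (LDU uniqueness)
import Literature.NumberTheory.Automorphic.UnitaryGroupAutomorphicRep  -- ★ `unitaryGroupOfForm`, ★ `StdForm.antidiagonal`, `StdForm.over_mul_over`, `transpose_over`
import HarnessLib

/-!
# The Gauss factors of a unitary matrix are unitary: for the antidiagonal form `J₀` the involution `θ(g) = J₀ ᵗ(σg)⁻¹ J₀` fixes exactly `U(σ, J₀)` and preserves the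
# shapes `lower unitriangular ∕ diagonal ∕ upper unitriangular`, so `g = ℓ·t·r ∈ U(σ, J₀)` forces `ℓ, t, r ∈ U(σ, J₀)` by uniqueness of the Gauss decomposition
# (Rogawski 1990 §1.9–§1.10; Springer, *Linear Algebraic Groups* 8.3.9–8.3.11; Schneider–Stuhler 1997 I.2.7)

Topic `NumberTheory/Automorphic`; namespaces `Literature.NumberTheory.Automorphic` (§0 descent, §1 shape lemmas — dot-notation on ★ `GaussCellGL`'s predicates) and
`Literature.NumberTheory.Automorphic.UnitaryGroup` (§1 `J₀` entries, §2–§5; ★ `UnitaryGroupBorelPair`'s letters namespace).  THEOREMS ONLY (no definition, no instance, no notation, no named fact, no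
`sorry`); imports ★ `GaussCellGL` + ★ `UnitaryGroupAutomorphicRep` only.  Cell `pub/hodgecm-mathlib` (D-0151), crux H413 = `stmt-HodgeConjecture-24833`; E1 BRICK LEDGER
row 39β-gen (keeper F0P3a-p03 (g29) 2026-09-03T01:34:07Z) = the GENERIC half (L4) of file β of the (U7) census `F0/P3b/LH6-p04/g11/u7/CENSUS-U7-geodesic-inclusion.v0` (LH6-p04
(g11)): its last § «(U7) on the standard apartment» imports this file.  HONEST LABEL: count-neutral generic base layer; HC_CM is proved only modulo the 2 remaining named inputs
(hLiu418 24832, h413 24833) until rung 0 closes; nothing printed is asserted here.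

DEDUP (what is ★ and only CITED): the Gauss predicates and **LDU uniqueness** ★ `gauss_unique` (`GaussCellGL`, Springer 8.3.9); existence on the big cell ★
`exists_gauss_decomposition_of_isUnit_leadMinor` (`GaussDecompositionOfUnitMinors`); `(J₀ X J₀)ᵢⱼ = X_{rev i, rev j}` ★ `antidiagonal_mul_mul_antidiagonal_apply` and «`J₀`-conjugation turns
lower into upper» ★ `blockTriangular_antidiagonal_conj_of_lower` (`IwasawaDecompositionArchUnitary`, archimedean import chain — re-proved here as the 3-line §1 entry lemma to keep this
file `p`-adic-light); `g⁻¹ = J₀ ᵗ(σg) J₀` on `U(σ, J₀)` ★ `UnitaryGroup.coe_inv_apply_of_mem_unitaryGroupOfForm_antidiagonal` and the Borel pair `B = T·N` of `U(σ, J₀)` ★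
`UnitaryGroupBorelPair` (upper factors only).  NEW here: the involution `θ` on ALL of `GL_N` (§2), its fixed points (§3), the generic descent lemma (§0) and the unitarity of the THREE
Gauss factors of a unitary element of the big cell (§4), in both the ★ predicate letters and the entrywise letters of the (U7) census (§5).

THE MATHEMATICS.  `K` a field, `σ : K →+* K` any ring endomorphism, `J₀ = antidiag(1, …, 1)` (★ `(StdForm.antidiagonal N).over K`, `J₀² = 1`, `ᵗJ₀ = J₀`).  Put
`θ(X) := J₀ · (ᵗ(σX))⁻¹ · J₀` (nonsingular inverse).  Then (§2) `θ(XY) = θ(X) θ(Y)`; entrywise `σ` and inversion preserve each of the three shapes, while transposition and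
`J₀`-conjugation each EXCHANGE lower and upper unitriangular (and preserve diagonal) — so `θ` PRESERVES all three shapes (§1–§2); (§3) for `det X ≠ 0`, `ᵗ(σX) J₀ X = J₀ ⟺ θ(X) = X`,
i.e. `U(σ, J₀) = GL_N^θ`.  (§0) If a product decomposition `x = l·d·u` with factors in three `θ`-stable classes is UNIQUE, then `θ(x) = x` forces `θ(l) = l`, `θ(d) = d`, `θ(u) = u`.
(§4) Hence for `g ∈ U(σ, J₀)` with `g = ℓ t r` (`ℓ` lower unitriangular, `t` diagonal invertible, `r` upper unitriangular): `ℓ, t, r ∈ U(σ, J₀)` — Rogawski's `B = MN` inside `G`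
extended to the big cell `N⁻MN`; this is the step of [SchneiderStuhler1997, I.2.7] (Iwahori factorisation inside the group) used by the lattice-model proof of (U7).

* §0 `apply_eq_of_unique_triple` (generic descent under a shape-preserving map).
* §1 `UnitaryGroup.antidiagonal_over_apply_eq`, `UnitaryGroup.antidiagonal_conj_apply` (`(J₀XJ₀)ᵢⱼ = X_{rev i, rev j}`), shape lemmas `IsBlock{Lower,Upper}Unipotent.map_ringHom ∕ .antidiagonal_conj`,
  `IsBlockDiagonalFor.map_ringHom ∕ .antidiagonal_conj ∕ .inv_of_det_ne_zero`.
* §2 `theta_mul`, `isBlockLowerUnipotent_theta`, `isBlockUpperUnipotent_theta`, `isBlockDiagonalFor_theta`, `det_theta_ne_zero` (all with `θ` written out).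
* §3 **`map_transpose_mul_antidiagonal_mul_eq_iff`** (`ᵗ(σX) J₀ X = J₀ ↔ θ X = X`), `mem_unitaryGroupOfForm_antidiagonal_iff_theta_eq`.
* §4 **`gauss_factors_unitary`** (matrix form), **`mem_unitaryGroupOfForm_of_gauss`** (`GL` form), `gauss_eq_of_eq` (LDU uniqueness as an equation, from ★ `gauss_unique`).
* §5 entrywise letters: `isBlockLowerUnipotent_id_iff`, `isBlockUpperUnipotent_id_iff`, `isBlockDiagonalFor_id_iff`, **`mem_unitaryGroupOfForm_of_lower_diag_upper`** (the census signature, all `N`);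
  Mathlib-`BlockTriangular` letters of the (U7) file α: `isBlock{Lower,Upper}Unipotent_id_iff_blockTriangular`, **`unitary_of_ldu_blockTriangular`** (matrix form, `det D ≠ 0` automatic).

## References
* [Rogawski1990] J. D. Rogawski, *Automorphic Representations of Unitary Groups in Three Variables* (1990), §1.9–§1.10 (`B = MN`, `g ↦ J ᵗḡ⁻¹ J`).
* [SpringerLAG1998] T. A. Springer, *Linear Algebraic Groups*, 2nd ed. (1998), 8.3.9, 8.3.11 (uniqueness in the big cell).
* [SchneiderStuhler1997] P. Schneider, U. Stuhler, *Representation theory and sheaves on the Bruhat–Tits building*, Publ. Math. IHÉS 85 (1997), I.2.7 (Iwahori factorisation of `U_x^{(e)}`).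
-/

set_option autoImplicit false

noncomputable section

open Matrix OrderDual
open scoped MatrixGroups

namespace Literature.NumberTheory.Automorphic

/-! ## §0 Generic descent: a unique three-factor decomposition descends to the fixed points of a shape-preserving map -/

section Descent

variable {M : Type*} [Mul M]

/-- **DESCENT OF A UNIQUE TRIPLE DECOMPOSITION.**  Let `θ : M → M` preserve three classes `PL`, `PD`, `PU` and satisfy `θ (l·d·u) = θ l · θ d · θ u` on the triple at hand; if
decompositions `l·d·u` with `PL l`, `PD d`, `PU u` are unique, then `θ (l d u) = l d u` forces `θ l = l`, `θ d = d`, `θ u = u`. [cite: SpringerLAG1998, 8.3.9] -/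
theorem apply_eq_of_unique_triple (θ : M → M) (PL PD PU : M → Prop) (hθL : ∀ x, PL x → PL (θ x)) (hθD : ∀ x, PD x → PD (θ x)) (hθU : ∀ x, PU x → PU (θ x))
    (huniq : ∀ ⦃l d u l' d' u' : M⦄, PL l → PD d → PU u → PL l' → PD d' → PU u' → l * d * u = l' * d' * u' → l = l' ∧ d = d' ∧ u = u')
    {l d u : M} (hl : PL l) (hd : PD d) (hu : PU u) (hmul : θ (l * d * u) = θ l * θ d * θ u) (hfix : θ (l * d * u) = l * d * u) :
    θ l = l ∧ θ d = d ∧ θ u = u :=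
  huniq (hθL _ hl) (hθD _ hd) (hθU _ hu) hl hd hu (hmul.symm.trans hfix)

end Descent

variable {K : Type*} [Field K] (σ : K →+* K) {N : ℕ}

/-! ## §1 The antidiagonal form `J₀`, and the shape of `X.map σ`, `J₀ X J₀`, `t⁻¹` -/

section Shapes

/-- Entries of `J₀ = antidiag(1, …, 1)` over `K`. [cite: Rogawski1990, §1.9] -/
theorem UnitaryGroup.antidiagonal_over_apply_eq (i j : Fin N) : (StdForm.antidiagonal N).over K i j = if j = i.rev then (1 : K) else 0 := by
  simp only [StdForm.over, Matrix.map_apply, StdForm.antidiagonal_J_apply]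
  split_ifs <;> simp

/-- `(J₀ X J₀)ᵢⱼ = X_{rev i, rev j}`: conjugation by `J₀` reverses rows and columns (the `p`-adic-light twin of ★ `antidiagonal_mul_mul_antidiagonal_apply`). [cite: Rogawski1990, §1.9] -/
theorem UnitaryGroup.antidiagonal_conj_apply (X : Matrix (Fin N) (Fin N) K) (i j : Fin N) :
    ((StdForm.antidiagonal N).over K * X * (StdForm.antidiagonal N).over K) i j = X i.rev j.rev := by
  have h1 : ∀ k, ((StdForm.antidiagonal N).over K * X) i k = X i.rev k := fun k => by
    rw [Matrix.mul_apply, Finset.sum_eq_single i.rev]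
    · rw [UnitaryGroup.antidiagonal_over_apply_eq, if_pos rfl, one_mul]
    · intro l _ hl; rw [UnitaryGroup.antidiagonal_over_apply_eq, if_neg hl, zero_mul]
    · intro h; exact absurd (Finset.mem_univ _) h
  rw [Matrix.mul_apply, Finset.sum_eq_single j.rev]
  · rw [h1, UnitaryGroup.antidiagonal_over_apply_eq, if_pos (Fin.rev_rev j).symm, mul_one]
  · intro l _ hl; rw [UnitaryGroup.antidiagonal_over_apply_eq, if_neg (fun h => hl (by rw [h, Fin.rev_rev])), mul_zero]
  · intro h; exact absurd (Finset.mem_univ _) h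

variable {σ}

/-- Entrywise `σ` preserves lower unitriangular matrices. [cite: SpringerLAG1998, 8.3.9] -/
theorem IsBlockLowerUnipotent.map_ringHom {ℓ : Matrix (Fin N) (Fin N) K} (hℓ : IsBlockLowerUnipotent (id : Fin N → Fin N) ℓ) : IsBlockLowerUnipotent (id : Fin N → Fin N) (ℓ.map σ) := by
  refine ⟨fun i j h => ?_, fun i j h => ?_⟩
  · rw [Matrix.map_apply, hℓ.1 h, map_zero]
  · rw [Matrix.map_apply, hℓ.2 i j h]
    obtain rfl : i = j := h
    rw [Matrix.one_apply_eq, map_one]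

/-- Entrywise `σ` preserves upper unitriangular matrices. [cite: SpringerLAG1998, 8.3.9] -/
theorem IsBlockUpperUnipotent.map_ringHom {r : Matrix (Fin N) (Fin N) K} (hr : IsBlockUpperUnipotent (id : Fin N → Fin N) r) : IsBlockUpperUnipotent (id : Fin N → Fin N) (r.map σ) := by
  refine ⟨fun i j h => ?_, fun i j h => ?_⟩
  · rw [Matrix.map_apply, hr.1 h, map_zero]
  · rw [Matrix.map_apply, hr.2 i j h]
    obtain rfl : i = j := h
    rw [Matrix.one_apply_eq, map_one]

/-- Entrywise `σ` preserves diagonal matrices. [cite: SpringerLAG1998, 8.3.9] -/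
theorem IsBlockDiagonalFor.map_ringHom {t : Matrix (Fin N) (Fin N) K} (ht : IsBlockDiagonalFor (id : Fin N → Fin N) t) : IsBlockDiagonalFor (id : Fin N → Fin N) (t.map σ) :=
  fun i j h => by rw [Matrix.map_apply, ht i j h, map_zero]

/-- `J₀`-conjugation turns LOWER unitriangular into UPPER unitriangular. [cite: Rogawski1990, §1.9] -/
theorem IsBlockLowerUnipotent.antidiagonal_conj {ℓ : Matrix (Fin N) (Fin N) K} (hℓ : IsBlockLowerUnipotent (id : Fin N → Fin N) ℓ) :
    IsBlockUpperUnipotent (id : Fin N → Fin N) ((StdForm.antidiagonal N).over K * ℓ * (StdForm.antidiagonal N).over K) := by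
  refine ⟨fun i j h => ?_, fun i j h => ?_⟩
  · rw [UnitaryGroup.antidiagonal_conj_apply]
    exact hℓ.1 (show toDual (id j.rev) < toDual (id i.rev) from toDual_lt_toDual.2 (Fin.rev_lt_rev.2 h))
  · obtain rfl : i = j := h
    rw [UnitaryGroup.antidiagonal_conj_apply, hℓ.2 _ _ rfl, Matrix.one_apply_eq, Matrix.one_apply_eq]

/-- `J₀`-conjugation turns UPPER unitriangular into LOWER unitriangular. [cite: Rogawski1990, §1.9] -/
theorem IsBlockUpperUnipotent.antidiagonal_conj {r : Matrix (Fin N) (Fin N) K} (hr : IsBlockUpperUnipotent (id : Fin N → Fin N) r) :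
    IsBlockLowerUnipotent (id : Fin N → Fin N) ((StdForm.antidiagonal N).over K * r * (StdForm.antidiagonal N).over K) := by
  refine ⟨fun i j h => ?_, fun i j h => ?_⟩
  · rw [UnitaryGroup.antidiagonal_conj_apply]
    exact hr.1 (show id j.rev < id i.rev from Fin.rev_lt_rev.2 (toDual_lt_toDual.1 h))
  · obtain rfl : i = j := h
    rw [UnitaryGroup.antidiagonal_conj_apply, hr.2 _ _ rfl, Matrix.one_apply_eq, Matrix.one_apply_eq]

/-- `J₀`-conjugation preserves diagonal matrices. [cite: Rogawski1990, §1.9] -/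
theorem IsBlockDiagonalFor.antidiagonal_conj {t : Matrix (Fin N) (Fin N) K} (ht : IsBlockDiagonalFor (id : Fin N → Fin N) t) :
    IsBlockDiagonalFor (id : Fin N → Fin N) ((StdForm.antidiagonal N).over K * t * (StdForm.antidiagonal N).over K) :=
  fun i j h => by rw [UnitaryGroup.antidiagonal_conj_apply]; exact ht _ _ fun h' => h (Fin.rev_injective h')

/-- The inverse of an invertible diagonal matrix is diagonal. [cite: SpringerLAG1998, 8.3.9] -/
theorem IsBlockDiagonalFor.inv_of_det_ne_zero {t : Matrix (Fin N) (Fin N) K} (ht : IsBlockDiagonalFor (id : Fin N → Fin N) t) (htu : t.det ≠ 0) :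
    IsBlockDiagonalFor (id : Fin N → Fin N) t⁻¹ := by
  haveI : Invertible t := invertibleOfIsUnitDet t (isUnit_iff_ne_zero.2 htu)
  have hu : t⁻¹.BlockTriangular (id : Fin N → Fin N) := blockTriangular_inv_of_blockTriangular ht.blockTriangular
  have hl : t⁻¹.BlockTriangular (toDual ∘ (id : Fin N → Fin N)) := blockTriangular_inv_of_blockTriangular ht.blockTriangular_dual
  intro i j h
  rcases lt_or_gt_of_ne h with h' | h'
  · exact hl (show toDual (id i) > toDual (id j) from toDual_lt_toDual.2 h')
  · exact hu h'

end Shapes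

end Literature.NumberTheory.Automorphic

namespace Literature.NumberTheory.Automorphic.UnitaryGroup

open Literature.NumberTheory.Automorphic

variable {K : Type*} [Field K] (σ : K →+* K) {N : ℕ}

/-! ## §2 The involution `θ(X) = J₀ · (ᵗ(σX))⁻¹ · J₀`: multiplicative and shape-preserving -/

section Theta

/-- **`θ` IS MULTIPLICATIVE**: `J₀ (ᵗσ(XY))⁻¹ J₀ = (J₀ (ᵗσX)⁻¹ J₀)(J₀ (ᵗσY)⁻¹ J₀)` (square matrices over a field; `J₀² = 1`). [cite: Rogawski1990, §1.9] -/
theorem theta_mul (X Y : Matrix (Fin N) (Fin N) K) :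
    (StdForm.antidiagonal N).over K * (((X * Y).map σ)ᵀ)⁻¹ * (StdForm.antidiagonal N).over K =
      ((StdForm.antidiagonal N).over K * ((X.map σ)ᵀ)⁻¹ * (StdForm.antidiagonal N).over K) *
        ((StdForm.antidiagonal N).over K * ((Y.map σ)ᵀ)⁻¹ * (StdForm.antidiagonal N).over K) := by
  rw [Matrix.map_mul, Matrix.transpose_mul, Matrix.mul_inv_rev]
  simp only [Matrix.mul_assoc]
  rw [← Matrix.mul_assoc ((StdForm.antidiagonal N).over K) ((StdForm.antidiagonal N).over K), StdForm.over_mul_over, Matrix.one_mul]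

variable {σ}

/-- `θ` preserves LOWER unitriangular matrices (`σ`: keeps; `ᵀ`: lower → upper; `⁻¹`: keeps; `J₀·J₀`: upper → lower). [cite: Rogawski1990, §1.9–§1.10] -/
theorem isBlockLowerUnipotent_theta {ℓ : Matrix (Fin N) (Fin N) K} (hℓ : IsBlockLowerUnipotent (id : Fin N → Fin N) ℓ) :
    IsBlockLowerUnipotent (id : Fin N → Fin N) ((StdForm.antidiagonal N).over K * ((ℓ.map σ)ᵀ)⁻¹ * (StdForm.antidiagonal N).over K) :=
  (hℓ.map_ringHom (σ := σ)).transpose.inv.antidiagonal_conj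

/-- `θ` preserves UPPER unitriangular matrices. [cite: Rogawski1990, §1.9–§1.10] -/
theorem isBlockUpperUnipotent_theta {r : Matrix (Fin N) (Fin N) K} (hr : IsBlockUpperUnipotent (id : Fin N → Fin N) r) :
    IsBlockUpperUnipotent (id : Fin N → Fin N) ((StdForm.antidiagonal N).over K * ((r.map σ)ᵀ)⁻¹ * (StdForm.antidiagonal N).over K) :=
  (hr.map_ringHom (σ := σ)).transpose.inv.antidiagonal_conj

/-- `θ` preserves invertible DIAGONAL matrices. [cite: Rogawski1990, §1.9–§1.10] -/
theorem isBlockDiagonalFor_theta {t : Matrix (Fin N) (Fin N) K} (ht : IsBlockDiagonalFor (id : Fin N → Fin N) t) (htu : t.det ≠ 0) :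
    IsBlockDiagonalFor (id : Fin N → Fin N) ((StdForm.antidiagonal N).over K * ((t.map σ)ᵀ)⁻¹ * (StdForm.antidiagonal N).over K) := by
  refine ((ht.map_ringHom (σ := σ)).transpose.inv_of_det_ne_zero ?_).antidiagonal_conj
  rw [Matrix.det_transpose, ← RingHom.mapMatrix_apply, ← RingHom.map_det]
  exact (map_ne_zero σ).2 htu

/-- `θ` preserves invertibility: `det (θ t) ≠ 0` when `det t ≠ 0`. [cite: Rogawski1990, §1.9] -/
theorem det_theta_ne_zero {t : Matrix (Fin N) (Fin N) K} (htu : t.det ≠ 0) :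
    ((StdForm.antidiagonal N).over K * ((t.map σ)ᵀ)⁻¹ * (StdForm.antidiagonal N).over K).det ≠ 0 := by
  have hJ : ((StdForm.antidiagonal N).over K).det ≠ 0 := fun h0 => by
    have := congrArg Matrix.det (StdForm.over_mul_over (StdForm.antidiagonal N) K)
    rw [Matrix.det_mul, h0, zero_mul, Matrix.det_one] at this
    exact zero_ne_one this
  have hσt : ((t.map σ)ᵀ).det ≠ 0 := by
    rw [Matrix.det_transpose, ← RingHom.mapMatrix_apply, ← RingHom.map_det]; exact (map_ne_zero σ).2 htu
  rw [Matrix.det_mul, Matrix.det_mul, Matrix.det_nonsing_inv, Ring.inverse_eq_inv']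
  exact mul_ne_zero (mul_ne_zero hJ (inv_ne_zero hσt)) hJ

end Theta

/-! ## §3 Fixed points of `θ` = the unitary group of `J₀` -/

section Fixed

/-- **`ᵗ(σX) J₀ X = J₀ ⟺ θ(X) = X`** for `det X ≠ 0`: the unitary group of `J₀` is the fixed-point set of `θ`. [cite: Rogawski1990, §1.9 p. 13] -/
theorem map_transpose_mul_antidiagonal_mul_eq_iff {X : Matrix (Fin N) (Fin N) K} (hX : X.det ≠ 0) :
    (X.map σ)ᵀ * (StdForm.antidiagonal N).over K * X = (StdForm.antidiagonal N).over K ↔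
      (StdForm.antidiagonal N).over K * ((X.map σ)ᵀ)⁻¹ * (StdForm.antidiagonal N).over K = X := by
  set J : Matrix (Fin N) (Fin N) K := (StdForm.antidiagonal N).over K with hJdef
  set A : Matrix (Fin N) (Fin N) K := (X.map σ)ᵀ with hAdef
  have hJJ : J * J = 1 := StdForm.over_mul_over _ K
  have hA : IsUnit A.det := by
    rw [hAdef, Matrix.det_transpose, ← RingHom.mapMatrix_apply, ← RingHom.map_det, isUnit_iff_ne_zero]
    exact (map_ne_zero σ).2 hX
  constructor
  · intro h
    -- `A J X = J` ⇒ `A (J X J) = 1` ⇒ `A⁻¹ = J X J` ⇒ `J A⁻¹ J = X`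
    have h1 : A * (J * X * J) = 1 := by
      rw [show A * (J * X * J) = A * J * X * J by simp only [Matrix.mul_assoc], h, hJJ]
    rw [Matrix.inv_eq_right_inv h1, show J * (J * X * J) * J = (J * J) * X * (J * J) by simp only [Matrix.mul_assoc], hJJ, Matrix.one_mul, Matrix.mul_one]
  · intro h
    -- `X = J A⁻¹ J` ⇒ `A J X = A J J A⁻¹ J = J`
    rw [← h, show A * J * (J * A⁻¹ * J) = A * (J * J) * A⁻¹ * J by simp only [Matrix.mul_assoc], hJJ, Matrix.mul_one, Matrix.mul_nonsing_inv _ hA, Matrix.one_mul]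

/-- **`U(σ, J₀) = GL_N^θ`**: `g ∈ U(σ, J₀) ↔ J₀ (ᵗσg)⁻¹ J₀ = g`. [cite: Rogawski1990, §1.9 p. 13] -/
theorem mem_unitaryGroupOfForm_antidiagonal_iff_theta_eq (g : GL (Fin N) K) :
    g ∈ unitaryGroupOfForm σ ((StdForm.antidiagonal N).over K) ↔
      (StdForm.antidiagonal N).over K * ((((g : Matrix (Fin N) (Fin N) K)).map σ)ᵀ)⁻¹ * (StdForm.antidiagonal N).over K = (g : Matrix (Fin N) (Fin N) K) :=
  map_transpose_mul_antidiagonal_mul_eq_iff σ (Matrix.isUnits_det_units g).ne_zero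

end Fixed

/-! ## §4 The Gauss factors of a unitary element of the big cell are unitary -/

section Gauss

/-- **LDU UNIQUENESS as an equation** (★ `gauss_unique`): two Gauss decompositions `ℓ t r = ℓ′ t′ r′` of the same matrix have the same factors. [cite: SpringerLAG1998, 8.3.9] -/
theorem gauss_eq_of_eq {ℓ t r ℓ' t' r' : Matrix (Fin N) (Fin N) K} (hℓ : IsBlockLowerUnipotent (id : Fin N → Fin N) ℓ) (ht : IsBlockDiagonalFor (id : Fin N → Fin N) t)
    (htu : t.det ≠ 0) (hr : IsBlockUpperUnipotent (id : Fin N → Fin N) r) (hℓ' : IsBlockLowerUnipotent (id : Fin N → Fin N) ℓ')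
    (ht' : IsBlockDiagonalFor (id : Fin N → Fin N) t') (htu' : t'.det ≠ 0) (hr' : IsBlockUpperUnipotent (id : Fin N → Fin N) r') (h : ℓ * t * r = ℓ' * t' * r') :
    ℓ = ℓ' ∧ t = t' ∧ r = r' := by
  obtain ⟨-, h1, h2, h3⟩ := gauss_unique (b := (id : Fin N → Fin N)) (g := ℓ * t * r) hℓ ht htu hr rfl
  obtain ⟨-, h1', h2', h3'⟩ := gauss_unique (b := (id : Fin N → Fin N)) (g := ℓ * t * r) hℓ' ht' htu' hr' h
  exact ⟨h1.trans h1'.symm, h2.trans h2'.symm, h3.trans h3'.symm⟩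

/-- **THE GAUSS FACTORS OF A UNITARY MATRIX ARE UNITARY** (matrix form).  If `ᵗ(σg) J₀ g = J₀` and `g = ℓ t r` with `ℓ` lower unitriangular, `t` diagonal invertible, `r` upper
unitriangular, then each of `ℓ`, `t`, `r` satisfies `ᵗ(σx) J₀ x = J₀` — `θ(g) = θ(ℓ)θ(t)θ(r)` is a second Gauss decomposition of `g`, so `θ` fixes the factors (§0 + ★ `gauss_unique`).
[cite: Rogawski1990, §1.9–§1.10] [cite: SchneiderStuhler1997, I.2.7] [cite: SpringerLAG1998, 8.3.9] -/
theorem gauss_factors_unitary {g ℓ t r : Matrix (Fin N) (Fin N) K} (hg : (g.map σ)ᵀ * (StdForm.antidiagonal N).over K * g = (StdForm.antidiagonal N).over K)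
    (hℓ : IsBlockLowerUnipotent (id : Fin N → Fin N) ℓ) (ht : IsBlockDiagonalFor (id : Fin N → Fin N) t) (htu : t.det ≠ 0) (hr : IsBlockUpperUnipotent (id : Fin N → Fin N) r)
    (h : g = ℓ * t * r) :
    (ℓ.map σ)ᵀ * (StdForm.antidiagonal N).over K * ℓ = (StdForm.antidiagonal N).over K ∧
      (t.map σ)ᵀ * (StdForm.antidiagonal N).over K * t = (StdForm.antidiagonal N).over K ∧
        (r.map σ)ᵀ * (StdForm.antidiagonal N).over K * r = (StdForm.antidiagonal N).over K := by
  set J : Matrix (Fin N) (Fin N) K := (StdForm.antidiagonal N).over K with hJdef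
  have hℓu : ℓ.det ≠ 0 := by rw [hℓ.det_eq_one]; exact one_ne_zero
  have hru : r.det ≠ 0 := by rw [hr.det_eq_one]; exact one_ne_zero
  have hgu : g.det ≠ 0 := by rw [h, Matrix.det_mul, Matrix.det_mul]; exact mul_ne_zero (mul_ne_zero hℓu htu) hru
  have hfix : J * ((g.map σ)ᵀ)⁻¹ * J = g := (map_transpose_mul_antidiagonal_mul_eq_iff σ hgu).1 hg
  -- §0 with `θ X = J (ᵗσX)⁻¹ J`, the three Gauss classes (diagonal := diagonal ∧ invertible), and ★ uniqueness
  have key := apply_eq_of_unique_triple (M := Matrix (Fin N) (Fin N) K) (fun X => J * ((X.map σ)ᵀ)⁻¹ * J)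
    (IsBlockLowerUnipotent (id : Fin N → Fin N)) (fun X => IsBlockDiagonalFor (id : Fin N → Fin N) X ∧ X.det ≠ 0) (IsBlockUpperUnipotent (id : Fin N → Fin N))
    (fun X hX => isBlockLowerUnipotent_theta hX) (fun X hX => ⟨isBlockDiagonalFor_theta hX.1 hX.2, det_theta_ne_zero hX.2⟩) (fun X hX => isBlockUpperUnipotent_theta hX)
    (fun l d u l' d' u' hl hd hu hl' hd' hu' e => gauss_eq_of_eq hl hd.1 hd.2 hu hl' hd'.1 hd'.2 hu' e)
    hℓ ⟨ht, htu⟩ hr (by rw [theta_mul, theta_mul]) (by rw [← h]; exact hfix)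
  obtain ⟨h1, h2, h3⟩ := key
  exact ⟨(map_transpose_mul_antidiagonal_mul_eq_iff σ hℓu).2 h1, (map_transpose_mul_antidiagonal_mul_eq_iff σ htu).2 h2, (map_transpose_mul_antidiagonal_mul_eq_iff σ hru).2 h3⟩

/-- **THE GAUSS FACTORS OF A UNITARY ELEMENT ARE UNITARY** (`GL` form): `g ∈ U(σ, J₀)`, `g = ℓ t r` a Gauss decomposition in `GL_N(K)` ⇒ `ℓ, t, r ∈ U(σ, J₀)`.
[cite: Rogawski1990, §1.9–§1.10] [cite: SchneiderStuhler1997, I.2.7] -/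
theorem mem_unitaryGroupOfForm_of_gauss {g ℓ t r : GL (Fin N) K} (hg : g ∈ unitaryGroupOfForm σ ((StdForm.antidiagonal N).over K))
    (hℓ : IsBlockLowerUnipotent (id : Fin N → Fin N) (ℓ : Matrix (Fin N) (Fin N) K)) (ht : IsBlockDiagonalFor (id : Fin N → Fin N) (t : Matrix (Fin N) (Fin N) K))
    (hr : IsBlockUpperUnipotent (id : Fin N → Fin N) (r : Matrix (Fin N) (Fin N) K)) (h : g = ℓ * t * r) :
    ℓ ∈ unitaryGroupOfForm σ ((StdForm.antidiagonal N).over K) ∧ t ∈ unitaryGroupOfForm σ ((StdForm.antidiagonal N).over K) ∧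
      r ∈ unitaryGroupOfForm σ ((StdForm.antidiagonal N).over K) :=
  gauss_factors_unitary σ hg hℓ ht (Matrix.isUnits_det_units t).ne_zero hr (by rw [h, Units.val_mul, Units.val_mul])

end Gauss

/-! ## §5 Entrywise letters (the (U7) census signature, any `N`) -/

section Entrywise

/-- Lower unitriangular, entrywise: `ℓᵢⱼ = 0` for `i < j` and `ℓᵢᵢ = 1`. [cite: SpringerLAG1998, 8.3.9] -/
theorem isBlockLowerUnipotent_id_iff (ℓ : Matrix (Fin N) (Fin N) K) :
    IsBlockLowerUnipotent (id : Fin N → Fin N) ℓ ↔ (∀ i j, i < j → ℓ i j = 0) ∧ ∀ i, ℓ i i = 1 := by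
  constructor
  · rintro ⟨h1, h2⟩
    exact ⟨fun i j h => h1 (show toDual (id j) < toDual (id i) from toDual_lt_toDual.2 h), fun i => by rw [h2 i i rfl, Matrix.one_apply_eq]⟩
  · rintro ⟨h1, h2⟩
    refine ⟨fun i j h => h1 i j (toDual_lt_toDual.1 h), fun i j h => ?_⟩
    obtain rfl : i = j := h
    rw [h2, Matrix.one_apply_eq]

/-- Upper unitriangular, entrywise: `rᵢⱼ = 0` for `j < i` and `rᵢᵢ = 1`. [cite: SpringerLAG1998, 8.3.9] -/
theorem isBlockUpperUnipotent_id_iff (r : Matrix (Fin N) (Fin N) K) :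
    IsBlockUpperUnipotent (id : Fin N → Fin N) r ↔ (∀ i j, j < i → r i j = 0) ∧ ∀ i, r i i = 1 := by
  constructor
  · rintro ⟨h1, h2⟩
    exact ⟨fun i j h => h1 h, fun i => by rw [h2 i i rfl, Matrix.one_apply_eq]⟩
  · rintro ⟨h1, h2⟩
    refine ⟨fun i j h => h1 i j h, fun i j h => ?_⟩
    obtain rfl : i = j := h
    rw [h2, Matrix.one_apply_eq]

/-- Diagonal, entrywise: `tᵢⱼ = 0` for `i ≠ j`. [cite: SpringerLAG1998, 8.3.9] -/
theorem isBlockDiagonalFor_id_iff (t : Matrix (Fin N) (Fin N) K) : IsBlockDiagonalFor (id : Fin N → Fin N) t ↔ ∀ i j, i ≠ j → t i j = 0 :=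
  Iff.rfl

/-- **THE (U7) CENSUS SIGNATURE, any `N`**: `g ∈ U(σ, J₀)` with `g = L · D · U`, `L` lower unitriangular, `D` diagonal, `U` upper unitriangular (entrywise letters)
⇒ `L, D, U ∈ U(σ, J₀)`.  No hypothesis on `σ` (involutivity is not needed). [cite: Rogawski1990, §1.9–§1.10] [cite: SchneiderStuhler1997, I.2.7] -/
theorem mem_unitaryGroupOfForm_of_lower_diag_upper {g L D U : GL (Fin N) K} (hg : g ∈ unitaryGroupOfForm σ ((StdForm.antidiagonal N).over K)) (hLDU : g = L * D * U)
    (hL : (∀ i j, i < j → (L : Matrix (Fin N) (Fin N) K) i j = 0) ∧ ∀ i, (L : Matrix (Fin N) (Fin N) K) i i = 1)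
    (hD : ∀ i j, i ≠ j → (D : Matrix (Fin N) (Fin N) K) i j = 0)
    (hU : (∀ i j, j < i → (U : Matrix (Fin N) (Fin N) K) i j = 0) ∧ ∀ i, (U : Matrix (Fin N) (Fin N) K) i i = 1) :
    L ∈ unitaryGroupOfForm σ ((StdForm.antidiagonal N).over K) ∧ D ∈ unitaryGroupOfForm σ ((StdForm.antidiagonal N).over K) ∧
      U ∈ unitaryGroupOfForm σ ((StdForm.antidiagonal N).over K) :=
  mem_unitaryGroupOfForm_of_gauss σ hg ((isBlockLowerUnipotent_id_iff _).2 hL) ((isBlockDiagonalFor_id_iff _).2 hD) ((isBlockUpperUnipotent_id_iff _).2 hU) hLDU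

/-- Lower unitriangular in Mathlib's `BlockTriangular` letters (the (U7) file α's shape clause): `ℓ.BlockTriangular toDual ∧ ∀ i, ℓ i i = 1`. [cite: SpringerLAG1998, 8.3.9] -/
theorem isBlockLowerUnipotent_id_iff_blockTriangular (ℓ : Matrix (Fin N) (Fin N) K) :
    IsBlockLowerUnipotent (id : Fin N → Fin N) ℓ ↔ ℓ.BlockTriangular OrderDual.toDual ∧ ∀ i, ℓ i i = 1 := by
  rw [isBlockLowerUnipotent_id_iff]
  exact and_congr_left fun _ => ⟨fun h i j hij => h i j (toDual_lt_toDual.1 hij), fun h i j hij => h (toDual_lt_toDual.2 hij)⟩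

/-- Upper unitriangular in Mathlib's `BlockTriangular` letters: `r.BlockTriangular id ∧ ∀ i, r i i = 1`. [cite: SpringerLAG1998, 8.3.9] -/
theorem isBlockUpperUnipotent_id_iff_blockTriangular (r : Matrix (Fin N) (Fin N) K) :
    IsBlockUpperUnipotent (id : Fin N → Fin N) r ↔ r.BlockTriangular id ∧ ∀ i, r i i = 1 := by
  rw [isBlockUpperUnipotent_id_iff]
  exact and_congr_left fun _ => ⟨fun h i j hij => h i j hij, fun h i j hij => h hij⟩

/-- **MATRIX FORM IN THE (U7) FILE-α LETTERS**: if `ᵗ(σg) J₀ g = J₀` and `g = L · D · U` with `L.BlockTriangular toDual`, unit diagonal, `D` diagonal, `U.BlockTriangular id`, unit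
diagonal (matrices, as produced by a Gauss elimination), then each factor satisfies the unitarity equation; `det D ≠ 0` is automatic (`det g = det D`, and `det g ≠ 0` from `ᵗ(σg) J₀ g = J₀`).
[cite: Rogawski1990, §1.9–§1.10] [cite: SchneiderStuhler1997, I.2.7] -/
theorem unitary_of_ldu_blockTriangular {g L D U : Matrix (Fin N) (Fin N) K} (hg : (g.map σ)ᵀ * (StdForm.antidiagonal N).over K * g = (StdForm.antidiagonal N).over K)
    (hLDU : g = L * D * U) (hL : L.BlockTriangular OrderDual.toDual ∧ ∀ i, L i i = 1) (hD : ∀ i j, i ≠ j → D i j = 0) (hU : U.BlockTriangular id ∧ ∀ i, U i i = 1) :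
    (L.map σ)ᵀ * (StdForm.antidiagonal N).over K * L = (StdForm.antidiagonal N).over K ∧
      (D.map σ)ᵀ * (StdForm.antidiagonal N).over K * D = (StdForm.antidiagonal N).over K ∧
        (U.map σ)ᵀ * (StdForm.antidiagonal N).over K * U = (StdForm.antidiagonal N).over K := by
  have hL' := (isBlockLowerUnipotent_id_iff_blockTriangular L).2 hL
  have hU' := (isBlockUpperUnipotent_id_iff_blockTriangular U).2 hU
  have hJ : ((StdForm.antidiagonal N).over K).det ≠ 0 := fun h0 => by
    have := congrArg Matrix.det (StdForm.over_mul_over (StdForm.antidiagonal N) K)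
    rw [Matrix.det_mul, h0, zero_mul, Matrix.det_one] at this
    exact zero_ne_one this
  have hgdet : g.det ≠ 0 := fun h0 => by
    have := congrArg Matrix.det hg
    rw [Matrix.det_mul, h0, mul_zero] at this
    exact hJ this.symm
  have hDu : D.det ≠ 0 := by
    rw [hLDU, Matrix.det_mul, Matrix.det_mul, hL'.det_eq_one, hU'.det_eq_one, one_mul, mul_one] at hgdet
    exact hgdet
  exact gauss_factors_unitary σ hg hL' ((isBlockDiagonalFor_id_iff D).2 hD) hDu hU' hLDU

end Entrywise

end Literature.NumberTheory.Automorphic.UnitaryGroup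

end
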